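/-
Copyright (c) 2026 the pub-hodgecm-mathlib formalisation cell (harness21).  Prover seat hodgecm-mathlib-F0P3a-p08 (g20): road «S3-ram» (LEAD F0P3a-plan (g13);
owner F0P3a-p06), (T2) G-side organ (Cnt2′), chair heir F0P3a-p07 (g15) RULING (13) (6): `stub_Zhyp` composition pen; part (z7-b) «ROW-0 HYPERBOLIC TOTAL IN SOCKET
CURRENCY, REGION AND POOLED CENSUS ABSTRACT» (both root-depth parities; A-p16 (g33) Z1 pattern); 2026-09-02.
-/
import Literature.NumberTheory.Rogawski1990.DepthZeroKappaTransferTypeOneRamifiedJunctionStrataCountHyperbolicCentred   -- ★ p849224 (this seat): raw heads at `ι(B₀, 1)`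
import Literature.NumberTheory.Rogawski1990.TypeTwoRamifiedFrameLiteralCentred                                       -- ★ p849231 (A-p19 (g29), (h1) FILE 2): `ncard_zero_frameLiteral_eq_rerooted_ram`, `forall_not_isRoot_charpoly_rerootedCentred_ram`
import Literature.NumberTheory.Rogawski1990.DepthZeroKappaTransferTypeTwoRamifiedAnisotropicTotalsOdd                    -- ★ p849189 (A-p16 (g33)): the CM dictionary imports (`ramifiedBlock_adicCompletion`, `isPrincipalIdealRing_integer_adicCompletion`, residue-field cardinality, `isUnit_two_integer_iff_valued_eq_one`, `exists_sq_eq_of_valued_sub_one_lt`)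
import HarnessLib

/-!
# The row-`0` closed totals of the HYPERBOLIC type-(2) literal `ι(ĝ_w, û_w)` at a tame-ramified place (odd ∕ even root depth), in the (α) socket's currency — region and
# pooled label counts kept abstract (Kottwitz 1986 §3; Rogawski 1990 §4.9)

Topic `NumberTheory/Rogawski1990`; namespace `Literature.NumberTheory.Rogawski1990.BlockLawHyp`.  THEOREMS ONLY (no definition, no instance, no notation, no named fact, no
`sorry`); kernel lane `--supports stmt-HodgeConjecture-24833`.  Cell `pub/hodgecm-mathlib` (D-0151), crux H413; road «S3-ram» (Literature seeding, count-neutral); (T2)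
G-side organ (Cnt2′); chair heir F0P3a-p07 (g15) RULING (13) (6): this seat is the COMPOSITION PEN of the (α) keeper's `stub_Zhyp_{zero}_{par}_{branch}` (the row-`0`
closed totals of the HYPERBOLIC literal).  GLUE ONLY, the hyperbolic twin of ★ p849189 `anisotropicTotal_zero_ram_of_census_odd` (A-p16 (g33)): the (α) cell's count
`#{M ∣ SD(Φ₃,w) M ∧ ι(ĝ_w, û_w)·M = M ∧ (ι(ĝ_w,û_w) − 1)M ⊆ ϖ²M}` (the `stub_T2G_zero_{par}_J0diff` first set-builder, CHARACTER FOR CHARACTER) is moved to the re-rooted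
centred literal `Γ = ι(B₀, 1)`, `B₀ = k⁻¹·(s·ĝ_w)·k` (★ p849231 `ncard_zero_frameLiteral_eq_rerooted_ram`, A-p19 (g29); `s·û₀₀ = 1`, `k ∈ U(σ_w, Φ₂,w)` A-p12's centring
conjugator), where ★ p849224 `strataCount_J₀_of_charpoly_block_raw_endoGL_one` (the route-B raw head with its literal slots discharged) reads it at `j = 4` as
`sR.card + NE·T₄(E_{mA+1}) + NP·T₄(P⁺_{mA}) + NM·T₄(P⁻_{mA})`, `q = (Ideal.absNorm v.asIdeal : ℂ)`.  The ROOT REGION `sR` (★ p849125 ⇒ the axis image of A-p12's W-ball) and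
the POOLED label counts `NE NP NM` over it ((4a) F0P3-p03 (g16) ∘ (4b) A-p12 (g25)) are carried as the raw head's binders `sR hsR hNE hNP hNM` at `γ′` VERBATIM; the block depth
`hd : |(B₀ − 1) i j| ≤ |ϖ|^m` is A-p12's centre bound (+ ★ p849231 §0).  The CM dictionary (`hres hnorm`, `|2| = 1`, principal units squares, `q = |𝓀_w|`, PID) is ★ by name.

* **`hyperbolicTotal_zero_ram_of_region_census_odd`** (odd root depth `m = 2mA + 3`: every regime-B cell), **`hyperbolicTotal_zero_ram_of_region_census_even`** (`m = 2mA + 2`: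
  the regime-A cells at even `N`).

HONEST LABEL: HC_CM is proved only modulo the 2 remaining named inputs (hLiu418 24832, h413 24833) until rung 0 closes; nothing printed is asserted here (composition of ★
theorems); «S3-ram» has no books consequence.

## References
* [Kottwitz1986] R. E. Kottwitz, *Base change for unit elements of Hecke algebras*, Compositio Math. 60 (1986), §3.
* [Rogawski1990] J. D. Rogawski, *Automorphic Representations of Unitary Groups in Three Variables*, Ann. of Math. Stud. 123 (1990), §4.9 pp. 54–56, Lemma 4.9.3.
* [BruhatTits1972] F. Bruhat, J. Tits, *Groupes réductifs sur un corps local I*, Publ. Math. IHÉS 41 (1972), §10.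
-/

set_option autoImplicit false

noncomputable section

open NumberField IsDedekindDomain Matrix Polynomial ValuativeRel
open Literature.NumberTheory.Automorphic Literature.NumberTheory.Automorphic.UnitaryGroup
open Literature.NumberTheory.Automorphic.UnitaryLatticeTree Literature.NumberTheory.Automorphic.HermitianLattice
open Literature.NumberTheory.GaloisRepresentations
open Literature.NumberTheory.Rogawski1990 Literature.NumberTheory.Rogawski1990.TypeOneRamifiedJunction
open scoped Matrix MatrixGroups ValuativeRel WithZero

namespace Literature.NumberTheory.Rogawski1990.BlockLawHyp

variable (L : Type) [Field L] [NumberField L] [IsCMField L] {v : HeightOneSpectrum (𝓞 ↥(maximalRealSubfield L))}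

set_option maxHeartbeats 1600000 in
-- budget only: statement-heavy lattice tokens (the ★ raw head's budget).
/-- **ROW-`0` CLOSED TOTAL OF THE HYPERBOLIC LITERAL IN SOCKET CURRENCY, ODD ROOT DEPTH `m = 2mA+3`.**  For the (α) cell's binders (`w hw he h2 ϖ hϖ hσϖ γH hu2 hirr`),
a centring unit `s` (`s·û₀₀ = 1`), A-p12's centring conjugator `k ∈ U(σ_w, Φ₂,w)` with the block depth `hd : |(B₀ − 1) i j| ≤ |ϖ|^m` of `B₀ = k⁻¹·(s·ĝ_w)·k`, the
re-rooted literal `γ′` with `↑γ′ = ι(B₀, 1)`, class constants `c₁ ε`, and the route-B ROOT REGION `sR` with POOLED root-label counts `NE NP NM` at `γ′` (raw-head currency):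
the socket's count `#{M ∣ SD(Φ₃,w) M, ι(ĝ_w,û_w)·M = M, (ι − 1)M ⊆ ϖ²M}`, cast to `ℂ`, equals `sR.card + NE·T₄(E_{mA+1}) + NP·T₄(P⁺_{mA}) + NM·T₄(P⁻_{mA})` with
`q = (Ideal.absNorm v.asIdeal : ℂ)`.  ★ p849231 ∘ ★ p849224. [cite: Rogawski1990, §4.9 Prop. 4.9.1 (a) p. 55, Lemma 4.9.3] [cite: Kottwitz1986, §3] [cite: BruhatTits1972, §10] -/
theorem hyperbolicTotal_zero_ram_of_region_census_odd (w : PlacesOver L v)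
    (hw : IsCMField.complexConj L • w.1 = w.1) (he : v.asIdeal.ramificationIdx' w.1.asIdeal ≠ 1)
    (h2 : IsUnit (2 : 𝒪[(w.1.adicCompletion L)]))
    (ϖ : w.1.adicCompletion L) (hϖ : Valued.v ϖ = WithZero.exp (-1 : ℤ)) (hσϖ : galAdicCompletionMap (L := L) (IsCMField.complexConj L) hw ϖ = -ϖ)
    (γH : ((cmDatum L 2 (Matrix.of fun i j : Fin 2 => if i.val + j.val + 1 = 2 then (1 : L) else 0)).Local v ×
      (cmDatum L 1 (Matrix.of fun i j : Fin 1 => if i.val + j.val + 1 = 1 then (1 : L) else 0)).Local v))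
    (hu2 : Valued.v (finGammaTwo L v γH w - 1) ≤ Valued.v (ϖ ^ 2))
    (hirr : ¬ ∃ x : (w.1.adicCompletion L), ((((γH.1.val : GL (Fin 2) (UnitaryGroup.LocalRing L v)).val.map
      (Pi.evalRingHom (fun w' : PlacesOver L v => w'.1.adicCompletion L) w))).charpoly).IsRoot x)
    (m : ℕ) (mA : ℕ) (hmA : m = 2 * mA + 3)
    (s : (w.1.adicCompletion L)ˣ) (hs : (s : w.1.adicCompletion L) * (((localNonsplitEquiv (IsCMField.complexConj L) (Matrix.of fun i j : Fin 1 => if i.val + j.val + 1 = 1 then (1 : L) else 0) (IsCMField.complexConj_ne_one L) w hw γH.2).val : GL (Fin 1) (w.1.adicCompletion L)) : Matrix (Fin 1) (Fin 1) (w.1.adicCompletion L)) 0 0 = 1)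
    (k : GL (Fin 2) (w.1.adicCompletion L))
    (hk : k ∈ unitaryGroupOfForm (galAdicCompletionMap (L := L) (IsCMField.complexConj L) hw)
      (placeForm (Matrix.of fun i j : Fin 2 => if i.val + j.val + 1 = 2 then (1 : L) else 0) w.1))
    (hd : ∀ i j, Valued.v (((((k⁻¹ * (Matrix.GeneralLinearGroup.scalar (Fin 2) s * ((localNonsplitEquiv (IsCMField.complexConj L) (Matrix.of fun i j : Fin 2 => if i.val + j.val + 1 = 2 then (1 : L) else 0) (IsCMField.complexConj_ne_one L) w hw γH.1).val : GL (Fin 2) (w.1.adicCompletion L))) * k) : GL (Fin 2) (w.1.adicCompletion L)) : Matrix (Fin 2) (Fin 2) (w.1.adicCompletion L)) - 1) i j) ≤ Valued.v ϖ ^ m)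
    (γ' : unitaryGroupOfForm (galAdicCompletionMap (L := L) (IsCMField.complexConj L) hw) ((StdForm.antidiagonal 3).over (w.1.adicCompletion L)))
    (hγ' : (γ' : GL (Fin 3) (w.1.adicCompletion L)) = endoGL ((k⁻¹ * (Matrix.GeneralLinearGroup.scalar (Fin 2) s * ((localNonsplitEquiv (IsCMField.complexConj L) (Matrix.of fun i j : Fin 2 => if i.val + j.val + 1 = 2 then (1 : L) else 0) (IsCMField.complexConj_ne_one L) w hw γH.1).val : GL (Fin 2) (w.1.adicCompletion L))) * k), (1 : GL (Fin 1) (w.1.adicCompletion L))))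
    (c₁ ε : w.1.adicCompletion L) (hc₁ : Valued.v c₁ = 1) (hεv : Valued.v ε = 1) (hε : ∀ z : (w.1.adicCompletion L), Valued.v z ≤ 1 → Valued.v (z ^ 2 - ε) = 1)
    (sR : Finset {M : Submodule (Valued.integer (w.1.adicCompletion L)) (Fin 3 → (w.1.adicCompletion L)) // IsVertex (galAdicCompletionMap (L := L) (IsCMField.complexConj L) hw) ϖ ((StdForm.antidiagonal 3).over (w.1.adicCompletion L)) M}) (hsR : ∀ vtx, vtx ∈ sR ↔ vtx ∈ {vtx : {M : Submodule (Valued.integer (w.1.adicCompletion L)) (Fin 3 → (w.1.adicCompletion L)) // IsVertex (galAdicCompletionMap (L := L) (IsCMField.complexConj L) hw) ϖ ((StdForm.antidiagonal 3).over (w.1.adicCompletion L)) M} | latticeGraphIso (galAdicCompletionMap (L := L) (IsCMField.complexConj L) hw) ϖ ((StdForm.antidiagonal 3).over (w.1.adicCompletion L)) γ' vtx = vtx ∧ IsSelfDualLattice (galAdicCompletionMap (L := L) (IsCMField.complexConj L) hw) ϖ ((StdForm.antidiagonal 3).over (w.1.adicCompletion L)) vtx.1 ∧ vtx.1.map ((Matrix.toLin'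 (((γ' : GL (Fin 3) (w.1.adicCompletion L)) : Matrix (Fin 3) (Fin 3) (w.1.adicCompletion L)) - 1)).restrictScalars (Valued.integer (w.1.adicCompletion L))) ≤ scaleLattice (ϖ ^ m) vtx.1})
    (NE NP NM : ℕ)
    (hNE : ∑ vtx ∈ sR, ({wtx | wtx ∈ {wtx | ∃ cx, ((latticeGraph (galAdicCompletionMap (L := L) (IsCMField.complexConj L) hw) ϖ ((StdForm.antidiagonal 3).over (w.1.adicCompletion L))).Adj vtx cx ∧ (latticeGraph (galAdicCompletionMap (L := L) (IsCMField.complexConj L) hw) ϖ ((StdForm.antidiagonal 3).over (w.1.adicCompletion L))).dist ⟨stdLattice (w.1.adicCompletion L) 3, 0, isSelfDualLattice_stdLattice_three_of_v hϖ⟩ cx = (latticeGraph (galAdicCompletionMap (L := L) (IsCMField.complexConj L) hw) ϖ ((StdForm.antidiagonal 3).over (w.1.adicCompletion L))).dist ⟨stdLattice (w.1.adicCompletion L) 3, 0, isSelfDualLattice_stdLattice_three_of_v hϖ⟩ vtx + 1 ∧ latticeGraphIso (galAdicCompletionMap (L := L) (IsCMField.complexConj L) hw) ϖ ((StdForm.antidiagonal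 3).over (w.1.adicCompletion L)) γ' cx = cx) ∧ ((latticeGraph (galAdicCompletionMap (L := L) (IsCMField.complexConj L) hw) ϖ ((StdForm.antidiagonal 3).over (w.1.adicCompletion L))).Adj cx wtx ∧ (latticeGraph (galAdicCompletionMap (L := L) (IsCMField.complexConj L) hw) ϖ ((StdForm.antidiagonal 3).over (w.1.adicCompletion L))).dist ⟨stdLattice (w.1.adicCompletion L) 3, 0, isSelfDualLattice_stdLattice_three_of_v hϖ⟩ wtx = (latticeGraph (galAdicCompletionMap (L := L) (IsCMField.complexConj L) hw) ϖ ((StdForm.antidiagonal 3).over (w.1.adicCompletion L))).dist ⟨stdLattice (w.1.adicCompletion L) 3, 0, isSelfDualLattice_stdLattice_three_of_v hϖ⟩ cx + 1 ∧ latticeGraphIso (galAdicCompletionMap (L := L) (IsCMField.complexConj L) hw) ϖ ((StdForm.antidiagonal 3).over (w.1.adicCompletion L)) γ' wtx = wtx)} ∧ (¬ wtx.1.map ((Matrix.toLin' (((γ' : GL (Fin 3) (w.1.adicCompletion L)) : Matrix (Fin 3) (Fin 3) (w.1.adicCompletion L)) - 1)).restrictScalars (Valued.integer (w.1.adicCompletion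 L))) ≤ scaleLattice (ϖ ^ m) wtx.1 ∧ (wtx.1.map ((Matrix.toLin' (((γ' : GL (Fin 3) (w.1.adicCompletion L)) : Matrix (Fin 3) (Fin 3) (w.1.adicCompletion L)) - 1)).restrictScalars (Valued.integer (w.1.adicCompletion L))) ≤ scaleLattice (ϖ ^ (m - 1)) wtx.1 ∧ ¬ wtx.1.map ((Matrix.toLin' (((γ' : GL (Fin 3) (w.1.adicCompletion L)) : Matrix (Fin 3) (Fin 3) (w.1.adicCompletion L)) - 1)).restrictScalars (Valued.integer (w.1.adicCompletion L))) ≤ scaleLattice (ϖ ^ m) wtx.1))}).ncard = NE)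
    (hNP : ∑ vtx ∈ sR, ({wtx | wtx ∈ {wtx | ∃ cx, ((latticeGraph (galAdicCompletionMap (L := L) (IsCMField.complexConj L) hw) ϖ ((StdForm.antidiagonal 3).over (w.1.adicCompletion L))).Adj vtx cx ∧ (latticeGraph (galAdicCompletionMap (L := L) (IsCMField.complexConj L) hw) ϖ ((StdForm.antidiagonal 3).over (w.1.adicCompletion L))).dist ⟨stdLattice (w.1.adicCompletion L) 3, 0, isSelfDualLattice_stdLattice_three_of_v hϖ⟩ cx = (latticeGraph (galAdicCompletionMap (L := L) (IsCMField.complexConj L) hw) ϖ ((StdForm.antidiagonal 3).over (w.1.adicCompletion L))).dist ⟨stdLattice (w.1.adicCompletion L) 3, 0, isSelfDualLattice_stdLattice_three_of_v hϖ⟩ vtx + 1 ∧ latticeGraphIso (galAdicCompletionMap (L := L) (IsCMField.complexConj L) hw) ϖ ((StdForm.antidiagonal 3).over (w.1.adicCompletion L)) γ' cx = cx) ∧ ((latticeGraph (galAdicCompletionMap (L := L) (IsCMField.complexConj L) hw) ϖ ((StdForm.antidiagonal 3).over (w.1.adicCompletion L))).Adj cx wtx ∧ (latticeGraph (galAdicCompletionMap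 (L := L) (IsCMField.complexConj L) hw) ϖ ((StdForm.antidiagonal 3).over (w.1.adicCompletion L))).dist ⟨stdLattice (w.1.adicCompletion L) 3, 0, isSelfDualLattice_stdLattice_three_of_v hϖ⟩ wtx = (latticeGraph (galAdicCompletionMap (L := L) (IsCMField.complexConj L) hw) ϖ ((StdForm.antidiagonal 3).over (w.1.adicCompletion L))).dist ⟨stdLattice (w.1.adicCompletion L) 3, 0, isSelfDualLattice_stdLattice_three_of_v hϖ⟩ cx + 1 ∧ latticeGraphIso (galAdicCompletionMap (L := L) (IsCMField.complexConj L) hw) ϖ ((StdForm.antidiagonal 3).over (w.1.adicCompletion L)) γ' wtx = wtx)} ∧ (¬ wtx.1.map ((Matrix.toLin' (((γ' : GL (Fin 3) (w.1.adicCompletion L)) : Matrix (Fin 3) (Fin 3) (w.1.adicCompletion L)) - 1)).restrictScalars (Valued.integer (w.1.adicCompletion L))) ≤ scaleLattice (ϖ ^ m) wtx.1 ∧ (wtx.1.map ((Matrix.toLin' (((γ' : GL (Fin 3) (w.1.adicCompletion L)) : Matrix (Fin 3) (Fin 3) (w.1.adicCompletion L)) - 1)).restrictScalars (Valued.integer (w.1.adicCompletion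 L))) ≤ scaleLattice (ϖ ^ (m - 2)) wtx.1 ∧ ¬ wtx.1.map ((Matrix.toLin' (((γ' : GL (Fin 3) (w.1.adicCompletion L)) : Matrix (Fin 3) (Fin 3) (w.1.adicCompletion L)) - 1)).restrictScalars (Valued.integer (w.1.adicCompletion L))) ≤ scaleLattice (ϖ ^ (m - 1)) wtx.1) ∧ ∃ y ∈ wtx.1, ∃ a : (w.1.adicCompletion L), Valued.v a = 1 ∧ Valued.v ((ϖ ^ (m - 2))⁻¹ * pairing (galAdicCompletionMap (L := L) (IsCMField.complexConj L) hw) ((StdForm.antidiagonal 3).over (w.1.adicCompletion L)) y ((((γ' : GL (Fin 3) (w.1.adicCompletion L)) : Matrix (Fin 3) (Fin 3) (w.1.adicCompletion L)) - 1) *ᵥ y) - (c₁) * a ^ 2) < 1)}).ncard = NP)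
    (hNM : ∑ vtx ∈ sR, ({wtx | wtx ∈ {wtx | ∃ cx, ((latticeGraph (galAdicCompletionMap (L := L) (IsCMField.complexConj L) hw) ϖ ((StdForm.antidiagonal 3).over (w.1.adicCompletion L))).Adj vtx cx ∧ (latticeGraph (galAdicCompletionMap (L := L) (IsCMField.complexConj L) hw) ϖ ((StdForm.antidiagonal 3).over (w.1.adicCompletion L))).dist ⟨stdLattice (w.1.adicCompletion L) 3, 0, isSelfDualLattice_stdLattice_three_of_v hϖ⟩ cx = (latticeGraph (galAdicCompletionMap (L := L) (IsCMField.complexConj L) hw) ϖ ((StdForm.antidiagonal 3).over (w.1.adicCompletion L))).dist ⟨stdLattice (w.1.adicCompletion L) 3, 0, isSelfDualLattice_stdLattice_three_of_v hϖ⟩ vtx + 1 ∧ latticeGraphIso (galAdicCompletionMap (L := L) (IsCMField.complexConj L) hw) ϖ ((StdForm.antidiagonal 3).over (w.1.adicCompletion L)) γ' cx = cx) ∧ ((latticeGraph (galAdicCompletionMap (L := L) (IsCMField.complexConj L) hw) ϖ ((StdForm.antidiagonal 3).over (w.1.adicCompletion L))).Adj cx wtx ∧ (latticeGraph (galAdicCompletionMap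 (L := L) (IsCMField.complexConj L) hw) ϖ ((StdForm.antidiagonal 3).over (w.1.adicCompletion L))).dist ⟨stdLattice (w.1.adicCompletion L) 3, 0, isSelfDualLattice_stdLattice_three_of_v hϖ⟩ wtx = (latticeGraph (galAdicCompletionMap (L := L) (IsCMField.complexConj L) hw) ϖ ((StdForm.antidiagonal 3).over (w.1.adicCompletion L))).dist ⟨stdLattice (w.1.adicCompletion L) 3, 0, isSelfDualLattice_stdLattice_three_of_v hϖ⟩ cx + 1 ∧ latticeGraphIso (galAdicCompletionMap (L := L) (IsCMField.complexConj L) hw) ϖ ((StdForm.antidiagonal 3).over (w.1.adicCompletion L)) γ' wtx = wtx)} ∧ (¬ wtx.1.map ((Matrix.toLin' (((γ' : GL (Fin 3) (w.1.adicCompletion L)) : Matrix (Fin 3) (Fin 3) (w.1.adicCompletion L)) - 1)).restrictScalars (Valued.integer (w.1.adicCompletion L))) ≤ scaleLattice (ϖ ^ m) wtx.1 ∧ (wtx.1.map ((Matrix.toLin' (((γ' : GL (Fin 3) (w.1.adicCompletion L)) : Matrix (Fin 3) (Fin 3) (w.1.adicCompletion L)) - 1)).restrictScalars (Valued.integer (w.1.adicCompletion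 L))) ≤ scaleLattice (ϖ ^ (m - 2)) wtx.1 ∧ ¬ wtx.1.map ((Matrix.toLin' (((γ' : GL (Fin 3) (w.1.adicCompletion L)) : Matrix (Fin 3) (Fin 3) (w.1.adicCompletion L)) - 1)).restrictScalars (Valued.integer (w.1.adicCompletion L))) ≤ scaleLattice (ϖ ^ (m - 1)) wtx.1) ∧ ¬ (∃ y ∈ wtx.1, ∃ a : (w.1.adicCompletion L), Valued.v a = 1 ∧ Valued.v ((ϖ ^ (m - 2))⁻¹ * pairing (galAdicCompletionMap (L := L) (IsCMField.complexConj L) hw) ((StdForm.antidiagonal 3).over (w.1.adicCompletion L)) y ((((γ' : GL (Fin 3) (w.1.adicCompletion L)) : Matrix (Fin 3) (Fin 3) (w.1.adicCompletion L)) - 1) *ᵥ y) - (c₁) * a ^ 2) < 1))}).ncard = NM) :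
    ({M : Submodule (Valued.integer (w.1.adicCompletion L)) (Fin 3 → (w.1.adicCompletion L)) | IsSelfDualLattice (galAdicCompletionMap (L := L) (IsCMField.complexConj L) hw) ϖ (placeForm (Matrix.of fun i j : Fin 3 => if i.val + j.val + 1 = 3 then (1 : L) else 0) w.1) M ∧ mapGL (endoGL (((localNonsplitEquiv (IsCMField.complexConj L) (Matrix.of fun i j : Fin 2 => if i.val + j.val + 1 = 2 then (1 : L) else 0) (IsCMField.complexConj_ne_one L) w hw γH.1).val : GL (Fin 2) (w.1.adicCompletion L)), ((localNonsplitEquiv (IsCMField.complexConj L) (Matrix.of fun i j : Fin 1 => if i.val + j.val + 1 = 1 then (1 : L) else 0) (IsCMField.complexConj_ne_one L) w hw γH.2).val : GL (Fin 1) (w.1.adicCompletion L)))) M = M ∧ M.map ((Matrix.toLin' (((endoGL (((localNonsplitEquiv (IsCMField.complexConj L) (Matrix.of fun i j : Fin 2 => if i.val + j.val + 1 = 2 then (1 : L) else 0) (IsCMField.complexConj_ne_one L) w hw γH.1).val : GL (Fin 2) (w.1.adicCompletion L)), ((localNonsplitEquiv (IsCMField.complexConj L) (Matrix.of fun i j :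 Fin 1 => if i.val + j.val + 1 = 1 then (1 : L) else 0) (IsCMField.complexConj_ne_one L) w hw γH.2).val : GL (Fin 1) (w.1.adicCompletion L))) : GL (Fin 3) (w.1.adicCompletion L)) : Matrix (Fin 3) (Fin 3) (w.1.adicCompletion L)) - 1)).restrictScalars (Valued.integer (w.1.adicCompletion L))) ≤ scaleLattice (ϖ ^ 2) M}.ncard : ℂ) =
      (sR.card : ℂ) + (NE : ℂ) * (∑ i ∈ Finset.range (mA + 1), (Ideal.absNorm v.asIdeal : ℂ) ^ (2 * i) + ∑ i ∈ Finset.range mA, (Ideal.absNorm v.asIdeal : ℂ) ^ (2 * mA + 1 + i)) +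
        (NP : ℂ) * ∑ i ∈ Finset.range mA, (Ideal.absNorm v.asIdeal : ℂ) ^ (2 * i) + (NM : ℂ) * ∑ i ∈ Finset.range mA, (Ideal.absNorm v.asIdeal : ℂ) ^ (2 * i) := by
  classical
  -- THE CM DRESS ⟶ the generic tame-ramified hypotheses of the route-B heads (A-p16 (g33) Z1 pattern)
  have hc1 : IsCMField.complexConj L ≠ 1 := IsCMField.complexConj_ne_one L
  have h2v : Valued.v (2 : (w.1.adicCompletion L)) = 1 := (isUnit_two_integer_iff_valued_eq_one L w.1).1 h2
  have hσσ : ∀ z : (w.1.adicCompletion L), (galAdicCompletionMap (L := L) (IsCMField.complexConj L) hw) ((galAdicCompletionMap (L := L) (IsCMField.complexConj L) hw) z) = z :=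
    galAdicCompletionMap_galAdicCompletionMap_of_smul_eq (IsCMField.complexConj L) w hc1 hw
  have hvσ : ∀ z : (w.1.adicCompletion L), Valued.v ((galAdicCompletionMap (L := L) (IsCMField.complexConj L) hw) z) = Valued.v z := fun z =>
    valued_galAdicCompletionMap (L := L) (IsCMField.complexConj L) hw z
  obtain ⟨-, -, -, hres, hnorm⟩ := ramifiedBlock_adicCompletion L v w hw he h2v
  haveI : Fintype (Valued.ResidueField (w.1.adicCompletion L)) := Fintype.ofFinite _
  haveI := isPrincipalIdealRing_integer_adicCompletion L v w
  have hq : (Fintype.card (Valued.ResidueField (w.1.adicCompletion L)) : ℂ) = (Ideal.absNorm v.asIdeal : ℂ) := by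
    congr 1
    rw [Fintype.card_eq_nat_card, ← natCard_residueField_eq_of_compatible, natCard_residueField_eq_of_ramified (IsCMField.complexConj L) v hc1 w hw he,
      Ideal.absNorm_apply, Submodule.cardQuot_apply]
  have hsq : ∀ t : (w.1.adicCompletion L), Valued.v (t - 1) < 1 → IsSquare t := fun t ht => by
    obtain ⟨r, hr, -⟩ := exists_sq_eq_of_valued_sub_one_lt w.1 h2v t ht
    exact ⟨r, by rw [← hr, sq]⟩
  -- the re-rooted centred block `B₀ = k⁻¹ (s ĝ_w) k`: rootless
  have hirr' := forall_not_isRoot_charpoly_rerootedCentred_ram L w hw γH hirr s k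
  -- THE strataCount_J₀_of_charpoly_block_raw_endoGL_one at `γ′ = ι(B₀, 1)`, zero row (`j = 4`)
  have key := strataCount_J₀_of_charpoly_block_raw_endoGL_one hσσ hvσ hσϖ hϖ hres h2v hnorm ((k⁻¹ * (Matrix.GeneralLinearGroup.scalar (Fin 2) s * ((localNonsplitEquiv (IsCMField.complexConj L) (Matrix.of fun i j : Fin 2 => if i.val + j.val + 1 = 2 then (1 : L) else 0) (IsCMField.complexConj_ne_one L) w hw γH.1).val : GL (Fin 2) (w.1.adicCompletion L))) * k)) hγ' hd hsq hirr'
    mA hmA c₁ ε hc₁ hεv hε (Fintype.card (Valued.ResidueField (w.1.adicCompletion L))) rfl sR hsR NE NP NM hNE hNP hNM 4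
  simp only [Matrix.cons_val] at key
  -- MOVE `ι(ĝ_w, û_w) ↦ Γ` ((h1) FILE 2 transport) and cast to `ℂ`
  rw [ncard_zero_frameLiteral_eq_rerooted_ram L w hw ϖ hϖ γH hu2 s hs k hk, ← hγ']
  rw [key]
  split_ifs <;> (simp only [Pi.add_apply, Pi.smul_apply, smul_eq_mul, Matrix.cons_val]; push_cast; rw [hq, mul_one])


set_option maxHeartbeats 1600000 in
-- budget only: statement-heavy lattice tokens (the ★ even head's budget).
/-- **ROW-`0` CLOSED TOTAL OF THE HYPERBOLIC LITERAL IN SOCKET CURRENCY, EVEN ROOT DEPTH `m = 2mA+2`** (regime A-even cells): as the odd twin, over ★ `strataCount_J₀_of_charpoly_block_even_endoGL_one`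
(F0P3-p03 (g16)'s even head ★ p848995 with slots discharged), census atoms `NE NO NP NM`:
`sR.card + NE·T₄(E_{mA}) + NO·T₄(O_{mA}) + NP·T₄(P⁺_{mA}) + NM·T₄(P⁻_{mA})` (`T₄(E_0) = 0`). [cite: Rogawski1990, §4.9 Prop. 4.9.1 (a) p. 55, Lemma 4.9.3] [cite: Kottwitz1986, §3] -/
theorem hyperbolicTotal_zero_ram_of_region_census_even (w : PlacesOver L v)
    (hw : IsCMField.complexConj L • w.1 = w.1) (he : v.asIdeal.ramificationIdx' w.1.asIdeal ≠ 1)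
    (h2 : IsUnit (2 : 𝒪[(w.1.adicCompletion L)]))
    (ϖ : w.1.adicCompletion L) (hϖ : Valued.v ϖ = WithZero.exp (-1 : ℤ)) (hσϖ : galAdicCompletionMap (L := L) (IsCMField.complexConj L) hw ϖ = -ϖ)
    (γH : ((cmDatum L 2 (Matrix.of fun i j : Fin 2 => if i.val + j.val + 1 = 2 then (1 : L) else 0)).Local v ×
      (cmDatum L 1 (Matrix.of fun i j : Fin 1 => if i.val + j.val + 1 = 1 then (1 : L) else 0)).Local v))
    (hu2 : Valued.v (finGammaTwo L v γH w - 1) ≤ Valued.v (ϖ ^ 2))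
    (hirr : ¬ ∃ x : (w.1.adicCompletion L), ((((γH.1.val : GL (Fin 2) (UnitaryGroup.LocalRing L v)).val.map
      (Pi.evalRingHom (fun w' : PlacesOver L v => w'.1.adicCompletion L) w))).charpoly).IsRoot x)
    (m : ℕ) (mA : ℕ) (hmA : m = 2 * mA + 2)
    (s : (w.1.adicCompletion L)ˣ) (hs : (s : w.1.adicCompletion L) * (((localNonsplitEquiv (IsCMField.complexConj L) (Matrix.of fun i j : Fin 1 => if i.val + j.val + 1 = 1 then (1 : L) else 0) (IsCMField.complexConj_ne_one L) w hw γH.2).val : GL (Fin 1) (w.1.adicCompletion L)) : Matrix (Fin 1) (Fin 1) (w.1.adicCompletion L)) 0 0 = 1)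
    (k : GL (Fin 2) (w.1.adicCompletion L))
    (hk : k ∈ unitaryGroupOfForm (galAdicCompletionMap (L := L) (IsCMField.complexConj L) hw)
      (placeForm (Matrix.of fun i j : Fin 2 => if i.val + j.val + 1 = 2 then (1 : L) else 0) w.1))
    (hd : ∀ i j, Valued.v (((((k⁻¹ * (Matrix.GeneralLinearGroup.scalar (Fin 2) s * ((localNonsplitEquiv (IsCMField.complexConj L) (Matrix.of fun i j : Fin 2 => if i.val + j.val + 1 = 2 then (1 : L) else 0) (IsCMField.complexConj_ne_one L) w hw γH.1).val : GL (Fin 2) (w.1.adicCompletion L))) * k) : GL (Fin 2) (w.1.adicCompletion L)) : Matrix (Fin 2) (Fin 2) (w.1.adicCompletion L)) - 1) i j) ≤ Valued.v ϖ ^ m)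
    (γ' : unitaryGroupOfForm (galAdicCompletionMap (L := L) (IsCMField.complexConj L) hw) ((StdForm.antidiagonal 3).over (w.1.adicCompletion L)))
    (hγ' : (γ' : GL (Fin 3) (w.1.adicCompletion L)) = endoGL ((k⁻¹ * (Matrix.GeneralLinearGroup.scalar (Fin 2) s * ((localNonsplitEquiv (IsCMField.complexConj L) (Matrix.of fun i j : Fin 2 => if i.val + j.val + 1 = 2 then (1 : L) else 0) (IsCMField.complexConj_ne_one L) w hw γH.1).val : GL (Fin 2) (w.1.adicCompletion L))) * k), (1 : GL (Fin 1) (w.1.adicCompletion L))))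
    (c₁ ε : w.1.adicCompletion L) (hc₁ : Valued.v c₁ = 1) (hεv : Valued.v ε = 1) (hε : ∀ z : (w.1.adicCompletion L), Valued.v z ≤ 1 → Valued.v (z ^ 2 - ε) = 1)
    (sR : Finset {M : Submodule (Valued.integer (w.1.adicCompletion L)) (Fin 3 → (w.1.adicCompletion L)) // IsVertex (galAdicCompletionMap (L := L) (IsCMField.complexConj L) hw) ϖ ((StdForm.antidiagonal 3).over (w.1.adicCompletion L)) M}) (hsR : ∀ vtx, vtx ∈ sR ↔ vtx ∈ {vtx : {M : Submodule (Valued.integer (w.1.adicCompletion L)) (Fin 3 → (w.1.adicCompletion L)) // IsVertex (galAdicCompletionMap (L := L) (IsCMField.complexConj L) hw) ϖ ((StdForm.antidiagonal 3).over (w.1.adicCompletion L)) M} | latticeGraphIso (galAdicCompletionMap (L := L) (IsCMField.complexConj L) hw) ϖ ((StdForm.antidiagonal 3).over (w.1.adicCompletion L)) γ' vtx = vtx ∧ IsSelfDualLattice (galAdicCompletionMap (L := L) (IsCMField.complexConj L) hw) ϖ ((StdForm.antidiagonal 3).over (w.1.adicCompletion L)) vtx.1 ∧ vtx.1.map ((Matrix.toLin'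 (((γ' : GL (Fin 3) (w.1.adicCompletion L)) : Matrix (Fin 3) (Fin 3) (w.1.adicCompletion L)) - 1)).restrictScalars (Valued.integer (w.1.adicCompletion L))) ≤ scaleLattice (ϖ ^ m) vtx.1})
    (NE NO NP NM : ℕ)
    (hNE : ∑ vtx ∈ sR, ({wtx | wtx ∈ {wtx | ∃ cx, ((latticeGraph (galAdicCompletionMap (L := L) (IsCMField.complexConj L) hw) ϖ ((StdForm.antidiagonal 3).over (w.1.adicCompletion L))).Adj vtx cx ∧ (latticeGraph (galAdicCompletionMap (L := L) (IsCMField.complexConj L) hw) ϖ ((StdForm.antidiagonal 3).over (w.1.adicCompletion L))).dist ⟨stdLattice (w.1.adicCompletion L) 3, 0, isSelfDualLattice_stdLattice_three_of_v hϖ⟩ cx = (latticeGraph (galAdicCompletionMap (L := L) (IsCMField.complexConj L) hw) ϖ ((StdForm.antidiagonal 3).over (w.1.adicCompletion L))).dist ⟨stdLattice (w.1.adicCompletion L) 3, 0, isSelfDualLattice_stdLattice_three_of_v hϖ⟩ vtx + 1 ∧ latticeGraphIso (galAdicCompletionMap (L := L) (IsCMField.complexConj L) hw) ϖ ((StdForm.antidiagonal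 3).over (w.1.adicCompletion L)) γ' cx = cx) ∧ ((latticeGraph (galAdicCompletionMap (L := L) (IsCMField.complexConj L) hw) ϖ ((StdForm.antidiagonal 3).over (w.1.adicCompletion L))).Adj cx wtx ∧ (latticeGraph (galAdicCompletionMap (L := L) (IsCMField.complexConj L) hw) ϖ ((StdForm.antidiagonal 3).over (w.1.adicCompletion L))).dist ⟨stdLattice (w.1.adicCompletion L) 3, 0, isSelfDualLattice_stdLattice_three_of_v hϖ⟩ wtx = (latticeGraph (galAdicCompletionMap (L := L) (IsCMField.complexConj L) hw) ϖ ((StdForm.antidiagonal 3).over (w.1.adicCompletion L))).dist ⟨stdLattice (w.1.adicCompletion L) 3, 0, isSelfDualLattice_stdLattice_three_of_v hϖ⟩ cx + 1 ∧ latticeGraphIso (galAdicCompletionMap (L := L) (IsCMField.complexConj L) hw) ϖ ((StdForm.antidiagonal 3).over (w.1.adicCompletion L)) γ' wtx = wtx)} ∧ (¬ wtx.1.map ((Matrix.toLin' (((γ' : GL (Fin 3) (w.1.adicCompletion L)) : Matrix (Fin 3) (Fin 3) (w.1.adicCompletion L)) - 1)).restrictScalars (Valued.integer (w.1.adicCompletion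 L))) ≤ scaleLattice (ϖ ^ m) wtx.1 ∧ (wtx.1.map ((Matrix.toLin' (((γ' : GL (Fin 3) (w.1.adicCompletion L)) : Matrix (Fin 3) (Fin 3) (w.1.adicCompletion L)) - 1)).restrictScalars (Valued.integer (w.1.adicCompletion L))) ≤ scaleLattice (ϖ ^ (m - 2)) wtx.1 ∧ ¬ wtx.1.map ((Matrix.toLin' (((γ' : GL (Fin 3) (w.1.adicCompletion L)) : Matrix (Fin 3) (Fin 3) (w.1.adicCompletion L)) - 1)).restrictScalars (Valued.integer (w.1.adicCompletion L))) ≤ scaleLattice (ϖ ^ (m - 1)) wtx.1))}).ncard = NE)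
    (hNO : ∑ vtx ∈ sR, ({wtx | wtx ∈ {wtx | ∃ cx, ((latticeGraph (galAdicCompletionMap (L := L) (IsCMField.complexConj L) hw) ϖ ((StdForm.antidiagonal 3).over (w.1.adicCompletion L))).Adj vtx cx ∧ (latticeGraph (galAdicCompletionMap (L := L) (IsCMField.complexConj L) hw) ϖ ((StdForm.antidiagonal 3).over (w.1.adicCompletion L))).dist ⟨stdLattice (w.1.adicCompletion L) 3, 0, isSelfDualLattice_stdLattice_three_of_v hϖ⟩ cx = (latticeGraph (galAdicCompletionMap (L := L) (IsCMField.complexConj L) hw) ϖ ((StdForm.antidiagonal 3).over (w.1.adicCompletion L))).dist ⟨stdLattice (w.1.adicCompletion L) 3, 0, isSelfDualLattice_stdLattice_three_of_v hϖ⟩ vtx + 1 ∧ latticeGraphIso (galAdicCompletionMap (L := L) (IsCMField.complexConj L) hw) ϖ ((StdForm.antidiagonal 3).over (w.1.adicCompletion L)) γ' cx = cx) ∧ ((latticeGraph (galAdicCompletionMap (L := L) (IsCMField.complexConj L) hw) ϖ ((StdForm.antidiagonal 3).over (w.1.adicCompletion L))).Adj cx wtx ∧ (latticeGraph (galAdicCompletionMap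 (L := L) (IsCMField.complexConj L) hw) ϖ ((StdForm.antidiagonal 3).over (w.1.adicCompletion L))).dist ⟨stdLattice (w.1.adicCompletion L) 3, 0, isSelfDualLattice_stdLattice_three_of_v hϖ⟩ wtx = (latticeGraph (galAdicCompletionMap (L := L) (IsCMField.complexConj L) hw) ϖ ((StdForm.antidiagonal 3).over (w.1.adicCompletion L))).dist ⟨stdLattice (w.1.adicCompletion L) 3, 0, isSelfDualLattice_stdLattice_three_of_v hϖ⟩ cx + 1 ∧ latticeGraphIso (galAdicCompletionMap (L := L) (IsCMField.complexConj L) hw) ϖ ((StdForm.antidiagonal 3).over (w.1.adicCompletion L)) γ' wtx = wtx)} ∧ (¬ wtx.1.map ((Matrix.toLin' (((γ' : GL (Fin 3) (w.1.adicCompletion L)) : Matrix (Fin 3) (Fin 3) (w.1.adicCompletion L)) - 1)).restrictScalars (Valued.integer (w.1.adicCompletion L))) ≤ scaleLattice (ϖ ^ m) wtx.1 ∧ (wtx.1.map ((Matrix.toLin' (((γ' : GL (Fin 3) (w.1.adicCompletion L)) : Matrix (Fin 3) (Fin 3) (w.1.adicCompletion L)) - 1)).restrictScalars (Valued.integer (w.1.adicCompletion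 L))) ≤ scaleLattice (ϖ ^ (m - 1)) wtx.1 ∧ ¬ wtx.1.map ((Matrix.toLin' (((γ' : GL (Fin 3) (w.1.adicCompletion L)) : Matrix (Fin 3) (Fin 3) (w.1.adicCompletion L)) - 1)).restrictScalars (Valued.integer (w.1.adicCompletion L))) ≤ scaleLattice (ϖ ^ m) wtx.1) ∧ ¬ wtx.1.map ((Matrix.toLin' ((((γ' : GL (Fin 3) (w.1.adicCompletion L)) : Matrix (Fin 3) (Fin 3) (w.1.adicCompletion L)) - 1) ^ 2)).restrictScalars (Valued.integer (w.1.adicCompletion L))) ≤ scaleLattice (ϖ ^ (2 * m - 1)) wtx.1)}).ncard = NO)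
    (hNP : ∑ vtx ∈ sR, ({wtx | wtx ∈ {wtx | ∃ cx, ((latticeGraph (galAdicCompletionMap (L := L) (IsCMField.complexConj L) hw) ϖ ((StdForm.antidiagonal 3).over (w.1.adicCompletion L))).Adj vtx cx ∧ (latticeGraph (galAdicCompletionMap (L := L) (IsCMField.complexConj L) hw) ϖ ((StdForm.antidiagonal 3).over (w.1.adicCompletion L))).dist ⟨stdLattice (w.1.adicCompletion L) 3, 0, isSelfDualLattice_stdLattice_three_of_v hϖ⟩ cx = (latticeGraph (galAdicCompletionMap (L := L) (IsCMField.complexConj L) hw) ϖ ((StdForm.antidiagonal 3).over (w.1.adicCompletion L))).dist ⟨stdLattice (w.1.adicCompletion L) 3, 0, isSelfDualLattice_stdLattice_three_of_v hϖ⟩ vtx + 1 ∧ latticeGraphIso (galAdicCompletionMap (L := L) (IsCMField.complexConj L) hw) ϖ ((StdForm.antidiagonal 3).over (w.1.adicCompletion L)) γ' cx = cx) ∧ ((latticeGraph (galAdicCompletionMap (L := L) (IsCMField.complexConj L) hw) ϖ ((StdForm.antidiagonal 3).over (w.1.adicCompletion L))).Adj cx wtx ∧ (latticeGraph (galAdicCompletionMap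 (L := L) (IsCMField.complexConj L) hw) ϖ ((StdForm.antidiagonal 3).over (w.1.adicCompletion L))).dist ⟨stdLattice (w.1.adicCompletion L) 3, 0, isSelfDualLattice_stdLattice_three_of_v hϖ⟩ wtx = (latticeGraph (galAdicCompletionMap (L := L) (IsCMField.complexConj L) hw) ϖ ((StdForm.antidiagonal 3).over (w.1.adicCompletion L))).dist ⟨stdLattice (w.1.adicCompletion L) 3, 0, isSelfDualLattice_stdLattice_three_of_v hϖ⟩ cx + 1 ∧ latticeGraphIso (galAdicCompletionMap (L := L) (IsCMField.complexConj L) hw) ϖ ((StdForm.antidiagonal 3).over (w.1.adicCompletion L)) γ' wtx = wtx)} ∧ (¬ wtx.1.map ((Matrix.toLin' (((γ' : GL (Fin 3) (w.1.adicCompletion L)) : Matrix (Fin 3) (Fin 3) (w.1.adicCompletion L)) - 1)).restrictScalars (Valued.integer (w.1.adicCompletion L))) ≤ scaleLattice (ϖ ^ m) wtx.1 ∧ (wtx.1.map ((Matrix.toLin' (((γ' : GL (Fin 3) (w.1.adicCompletion L)) : Matrix (Fin 3) (Fin 3) (w.1.adicCompletion L)) - 1)).restrictScalars (Valued.integer (w.1.adicCompletion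 L))) ≤ scaleLattice (ϖ ^ (m - 1)) wtx.1 ∧ ¬ wtx.1.map ((Matrix.toLin' (((γ' : GL (Fin 3) (w.1.adicCompletion L)) : Matrix (Fin 3) (Fin 3) (w.1.adicCompletion L)) - 1)).restrictScalars (Valued.integer (w.1.adicCompletion L))) ≤ scaleLattice (ϖ ^ m) wtx.1) ∧ wtx.1.map ((Matrix.toLin' ((((γ' : GL (Fin 3) (w.1.adicCompletion L)) : Matrix (Fin 3) (Fin 3) (w.1.adicCompletion L)) - 1) ^ 2)).restrictScalars (Valued.integer (w.1.adicCompletion L))) ≤ scaleLattice (ϖ ^ (2 * m - 1)) wtx.1 ∧ ∃ y ∈ wtx.1, ∃ a : (w.1.adicCompletion L), Valued.v a = 1 ∧ Valued.v ((ϖ ^ (m - 1))⁻¹ * pairing (galAdicCompletionMap (L := L) (IsCMField.complexConj L) hw) ((StdForm.antidiagonal 3).over (w.1.adicCompletion L)) y ((((γ' : GL (Fin 3) (w.1.adicCompletion L)) : Matrix (Fin 3) (Fin 3) (w.1.adicCompletion L)) - 1) *ᵥ y) - (c₁) * a ^ 2) < 1)}).ncard = NP)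
    (hNM : ∑ vtx ∈ sR, ({wtx | wtx ∈ {wtx | ∃ cx, ((latticeGraph (galAdicCompletionMap (L := L) (IsCMField.complexConj L) hw) ϖ ((StdForm.antidiagonal 3).over (w.1.adicCompletion L))).Adj vtx cx ∧ (latticeGraph (galAdicCompletionMap (L := L) (IsCMField.complexConj L) hw) ϖ ((StdForm.antidiagonal 3).over (w.1.adicCompletion L))).dist ⟨stdLattice (w.1.adicCompletion L) 3, 0, isSelfDualLattice_stdLattice_three_of_v hϖ⟩ cx = (latticeGraph (galAdicCompletionMap (L := L) (IsCMField.complexConj L) hw) ϖ ((StdForm.antidiagonal 3).over (w.1.adicCompletion L))).dist ⟨stdLattice (w.1.adicCompletion L) 3, 0, isSelfDualLattice_stdLattice_three_of_v hϖ⟩ vtx + 1 ∧ latticeGraphIso (galAdicCompletionMap (L := L) (IsCMField.complexConj L) hw) ϖ ((StdForm.antidiagonal 3).over (w.1.adicCompletion L)) γ' cx = cx) ∧ ((latticeGraph (galAdicCompletionMap (L := L) (IsCMField.complexConj L) hw) ϖ ((StdForm.antidiagonal 3).over (w.1.adicCompletion L))).Adj cx wtx ∧ (latticeGraph (galAdicCompletionMap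 (L := L) (IsCMField.complexConj L) hw) ϖ ((StdForm.antidiagonal 3).over (w.1.adicCompletion L))).dist ⟨stdLattice (w.1.adicCompletion L) 3, 0, isSelfDualLattice_stdLattice_three_of_v hϖ⟩ wtx = (latticeGraph (galAdicCompletionMap (L := L) (IsCMField.complexConj L) hw) ϖ ((StdForm.antidiagonal 3).over (w.1.adicCompletion L))).dist ⟨stdLattice (w.1.adicCompletion L) 3, 0, isSelfDualLattice_stdLattice_three_of_v hϖ⟩ cx + 1 ∧ latticeGraphIso (galAdicCompletionMap (L := L) (IsCMField.complexConj L) hw) ϖ ((StdForm.antidiagonal 3).over (w.1.adicCompletion L)) γ' wtx = wtx)} ∧ (¬ wtx.1.map ((Matrix.toLin' (((γ' : GL (Fin 3) (w.1.adicCompletion L)) : Matrix (Fin 3) (Fin 3) (w.1.adicCompletion L)) - 1)).restrictScalars (Valued.integer (w.1.adicCompletion L))) ≤ scaleLattice (ϖ ^ m) wtx.1 ∧ (wtx.1.map ((Matrix.toLin' (((γ' : GL (Fin 3) (w.1.adicCompletion L)) : Matrix (Fin 3) (Fin 3) (w.1.adicCompletion L)) - 1)).restrictScalars (Valued.integer (w.1.adicCompletion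 L))) ≤ scaleLattice (ϖ ^ (m - 1)) wtx.1 ∧ ¬ wtx.1.map ((Matrix.toLin' (((γ' : GL (Fin 3) (w.1.adicCompletion L)) : Matrix (Fin 3) (Fin 3) (w.1.adicCompletion L)) - 1)).restrictScalars (Valued.integer (w.1.adicCompletion L))) ≤ scaleLattice (ϖ ^ m) wtx.1) ∧ wtx.1.map ((Matrix.toLin' ((((γ' : GL (Fin 3) (w.1.adicCompletion L)) : Matrix (Fin 3) (Fin 3) (w.1.adicCompletion L)) - 1) ^ 2)).restrictScalars (Valued.integer (w.1.adicCompletion L))) ≤ scaleLattice (ϖ ^ (2 * m - 1)) wtx.1 ∧ ¬ (∃ y ∈ wtx.1, ∃ a : (w.1.adicCompletion L), Valued.v a = 1 ∧ Valued.v ((ϖ ^ (m - 1))⁻¹ * pairing (galAdicCompletionMap (L := L) (IsCMField.complexConj L) hw) ((StdForm.antidiagonal 3).over (w.1.adicCompletion L)) y ((((γ' : GL (Fin 3) (w.1.adicCompletion L)) : Matrix (Fin 3) (Fin 3) (w.1.adicCompletion L)) - 1) *ᵥ y) - (c₁) * a ^ 2) < 1))}).ncard = NM) :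
    ({M : Submodule (Valued.integer (w.1.adicCompletion L)) (Fin 3 → (w.1.adicCompletion L)) | IsSelfDualLattice (galAdicCompletionMap (L := L) (IsCMField.complexConj L) hw) ϖ (placeForm (Matrix.of fun i j : Fin 3 => if i.val + j.val + 1 = 3 then (1 : L) else 0) w.1) M ∧ mapGL (endoGL (((localNonsplitEquiv (IsCMField.complexConj L) (Matrix.of fun i j : Fin 2 => if i.val + j.val + 1 = 2 then (1 : L) else 0) (IsCMField.complexConj_ne_one L) w hw γH.1).val : GL (Fin 2) (w.1.adicCompletion L)), ((localNonsplitEquiv (IsCMField.complexConj L) (Matrix.of fun i j : Fin 1 => if i.val + j.val + 1 = 1 then (1 : L) else 0) (IsCMField.complexConj_ne_one L) w hw γH.2).val : GL (Fin 1) (w.1.adicCompletion L)))) M = M ∧ M.map ((Matrix.toLin' (((endoGL (((localNonsplitEquiv (IsCMField.complexConj L) (Matrix.of fun i j : Fin 2 => if i.val + j.val + 1 = 2 then (1 : L) else 0) (IsCMField.complexConj_ne_one L) w hw γH.1).val : GL (Fin 2) (w.1.adicCompletion L)), ((localNonsplitEquiv (IsCMField.complexConj L) (Matrix.of fun i j :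 Fin 1 => if i.val + j.val + 1 = 1 then (1 : L) else 0) (IsCMField.complexConj_ne_one L) w hw γH.2).val : GL (Fin 1) (w.1.adicCompletion L))) : GL (Fin 3) (w.1.adicCompletion L)) : Matrix (Fin 3) (Fin 3) (w.1.adicCompletion L)) - 1)).restrictScalars (Valued.integer (w.1.adicCompletion L))) ≤ scaleLattice (ϖ ^ 2) M}.ncard : ℂ) =
      (sR.card : ℂ) + (NE : ℂ) * (if mA = 0 then (0 : ℂ) else (∑ i ∈ Finset.range (mA - 1 + 1), (Ideal.absNorm v.asIdeal : ℂ) ^ (2 * i) + ∑ i ∈ Finset.range (mA - 1), (Ideal.absNorm v.asIdeal : ℂ) ^ (2 * (mA - 1) + 1 + i))) +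
        (NO : ℂ) * (∑ i ∈ Finset.range mA, (Ideal.absNorm v.asIdeal : ℂ) ^ (2 * i) + ∑ i ∈ Finset.range mA, (Ideal.absNorm v.asIdeal : ℂ) ^ (2 * mA - 1 + i)) +
        (NP : ℂ) * ∑ i ∈ Finset.range mA, (Ideal.absNorm v.asIdeal : ℂ) ^ (2 * i) + (NM : ℂ) * ∑ i ∈ Finset.range mA, (Ideal.absNorm v.asIdeal : ℂ) ^ (2 * i) := by
  classical
  -- THE CM DRESS ⟶ the generic tame-ramified hypotheses of the route-B heads (A-p16 (g33) Z1 pattern)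
  have hc1 : IsCMField.complexConj L ≠ 1 := IsCMField.complexConj_ne_one L
  have h2v : Valued.v (2 : (w.1.adicCompletion L)) = 1 := (isUnit_two_integer_iff_valued_eq_one L w.1).1 h2
  have hσσ : ∀ z : (w.1.adicCompletion L), (galAdicCompletionMap (L := L) (IsCMField.complexConj L) hw) ((galAdicCompletionMap (L := L) (IsCMField.complexConj L) hw) z) = z :=
    galAdicCompletionMap_galAdicCompletionMap_of_smul_eq (IsCMField.complexConj L) w hc1 hw
  have hvσ : ∀ z : (w.1.adicCompletion L), Valued.v ((galAdicCompletionMap (L := L) (IsCMField.complexConj L) hw) z) = Valued.v z := fun z =>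
    valued_galAdicCompletionMap (L := L) (IsCMField.complexConj L) hw z
  obtain ⟨-, -, -, hres, hnorm⟩ := ramifiedBlock_adicCompletion L v w hw he h2v
  haveI : Fintype (Valued.ResidueField (w.1.adicCompletion L)) := Fintype.ofFinite _
  haveI := isPrincipalIdealRing_integer_adicCompletion L v w
  have hq : (Fintype.card (Valued.ResidueField (w.1.adicCompletion L)) : ℂ) = (Ideal.absNorm v.asIdeal : ℂ) := by
    congr 1
    rw [Fintype.card_eq_nat_card, ← natCard_residueField_eq_of_compatible, natCard_residueField_eq_of_ramified (IsCMField.complexConj L) v hc1 w hw he,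
      Ideal.absNorm_apply, Submodule.cardQuot_apply]
  have hsq : ∀ t : (w.1.adicCompletion L), Valued.v (t - 1) < 1 → IsSquare t := fun t ht => by
    obtain ⟨r, hr, -⟩ := exists_sq_eq_of_valued_sub_one_lt w.1 h2v t ht
    exact ⟨r, by rw [← hr, sq]⟩
  -- the re-rooted centred block `B₀ = k⁻¹ (s ĝ_w) k`: rootless
  have hirr' := forall_not_isRoot_charpoly_rerootedCentred_ram L w hw γH hirr s k
  -- THE strataCount_J₀_of_charpoly_block_even_endoGL_one at `γ′ = ι(B₀, 1)`, zero row (`j = 4`)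
  have key := strataCount_J₀_of_charpoly_block_even_endoGL_one hσσ hvσ hσϖ hϖ hres h2v hnorm ((k⁻¹ * (Matrix.GeneralLinearGroup.scalar (Fin 2) s * ((localNonsplitEquiv (IsCMField.complexConj L) (Matrix.of fun i j : Fin 2 => if i.val + j.val + 1 = 2 then (1 : L) else 0) (IsCMField.complexConj_ne_one L) w hw γH.1).val : GL (Fin 2) (w.1.adicCompletion L))) * k)) hγ' hd hsq hirr'
    mA hmA c₁ ε hc₁ hεv hε (Fintype.card (Valued.ResidueField (w.1.adicCompletion L))) rfl sR hsR NE NO NP NM hNE hNO hNP hNM 4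
  simp only [Matrix.cons_val] at key
  -- MOVE `ι(ĝ_w, û_w) ↦ Γ` ((h1) FILE 2 transport) and cast to `ℂ`
  rw [ncard_zero_frameLiteral_eq_rerooted_ram L w hw ϖ hϖ γH hu2 s hs k hk, ← hγ']
  rw [key]
  split_ifs <;> (simp only [Pi.add_apply, Pi.smul_apply, smul_eq_mul, Matrix.cons_val]; push_cast; rw [hq, mul_one])

end Literature.NumberTheory.Rogawski1990.BlockLawHyp

end
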